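import Summits.QuantumFields.GaugeBoot.DiagonalRPTorusTubeRingsOdd
import Summits.QuantumFields.GaugeBoot.DiagonalRPTorusTubeMatch
import HarnessLib

/-!
# Small back-expansion terms on the odd torus: four covering faces and the short tubes
(gauge-boot, L3 sequel, odd case 2/4)

HONEST FRAMING (cell `pub-gaugeboot`, page 1 of every file): the venture produces certified bounds
on lattice expectations at stated coupling, gauge group, dimension and torus size; NOT a mass gap,
NOT a continuum limit, NOT a string tension; NOT Yang–Mills-summit-bearing (barriers
`FixedCouplingUltralocality`, `PerturbativeInvisibility`). This module is bookkeeping for a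
structural NEGATIVE result (`DiagonalRPTorusClosedHalfNegativeHighDim`); it discharges nothing by
itself.

## Content (torus `(ℤ/L)^d`, `L = 2c + 1`, `c ≥ 1`, `i < j < k < l`, closed half `h = c + 1`,
squares `v = sq k l x` on the layer `c` and `u = sq k l z` on the ADJACENT layer `-c = c + 1`,
centre element `ρ z₀ = ω • 1`, `ω ≠ 1`)

The odd twin of `DiagonalRPTorusTubeCover` / `TubeShape` / `TubeMatch`: for `Q ⊆ restPlaqs`,
`|Q| ≤ 4` and `T_Q(u, v) ≠ 0`, the four edges of `v` are covered by four distinct faces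
`qv a ∈ Q` (one of the two ring faces of `cover_low_odd` each), which exhaust `Q`
(`cover_structure_odd`); mixed corners are killed by a lonely link, so the faces have a uniform
type; the edges of `u` must then be edges of the other square of these faces, whence
(★ **`tube_shape_odd`**) `z = x + e_i` with `Q` the four `+e_i` faces over `v`, or `z = x - e_j`
with `Q` the four `-e_j` faces; corollaries `pairT_eq_zero_of_ne_offsets_odd`,
`eq_ringI_of_pairT_ne_zero`, `eq_ringJ_of_pairT_ne_zero`.

Elementary bookkeeping; no named fact.
-/

open MeasureTheory Finset Function

namespace Summit.QuantumFields.GaugeBoot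

open Literature.MathematicalPhysics.QuantumFieldTheory
open Summit.Ventures.YMGap.RobustBall (one_ne_zero_of_three_le two_ne_zero_of_three_le)

noncomputable section

namespace DiagRPTube

variable {d L : ℕ} [NeZero L] {N : ℕ} {G : Type*} [Group G] [TopologicalSpace G]
  [IsTopologicalGroup G] [CompactSpace G] [MeasurableSpace G] [BorelSpace G]
  [SecondCountableTopology G] {ρ : G →* Matrix (Fin N) (Fin N) ℂ} {β : ℝ}
  {i j k l : Fin d} (hij : i < j) (hjk : j < k) (hkl : k < l) {c : ℕ} (hc : 1 ≤ c)
  (hL : L = 2 * c + 1) (hρ : Continuous ρ) {z₀ : G} {ω : ℂ}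
  (hz₀ : ρ z₀ = ω • (1 : Matrix (Fin N) (Fin N) ℂ)) (hω : ω ≠ 1)
  {x z : Site d L} (hx : lay i j x = ((c : ℕ) : ZMod L)) (hz : lay i j z = -((c : ℕ) : ZMod L))

include hc hL in
omit [NeZero L] in
/-- `c ≠ -c` in `ℤ/(2c+1)`: the two observable layers differ. -/
theorem cast_c_ne_neg_odd : ((c : ℕ) : ZMod L) ≠ -((c : ℕ) : ZMod L) := by
  rw [neg_cast_c_odd hL]
  intro h
  have := congrArg ZMod.val h
  rw [val_cast (by omega), val_cast (by omega)] at this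
  omega

include hij hjk hkl hc hL hρ hz₀ hω hx hz

/-- ★ **The four covering faces (odd torus).** For `Q ⊆ restPlaqs`, `|Q| ≤ 4`, `T_Q(u,v) ≠ 0`:
covering faces `qv a ∈ Q` of the edges of `v`, each one of the two faces of `cover_low_odd`,
exhausting `Q`; and every edge of `u` lies in one of them. -/
theorem cover_structure_odd {Q : Finset (Plaquette d L)} (hQ : Q ⊆ restPlaqs i j (c + 1))
    (hcard : Q.card ≤ 4) (hT : pairT ρ β Q (sq k l hkl z) (sq k l hkl x) ≠ 0) :
    ∃ qv : Fin 4 → Plaquette d L,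
      (∀ a, qv a ∈ Q ∧ HasLink (qv a) (link (sq k l hkl x) a) ∧
        (qv a = ring (hij.trans hjk) (hij.trans (hjk.trans hkl)) x a ∨
          qv a = ring hjk (hjk.trans hkl) (dn x j) a)) ∧
      (∀ q ∈ Q, ∃ a, q = qv a) ∧ (∀ b, ∃ a, HasLink (qv a) (link (sq k l hkl z) b)) := by
  have hL3 : 3 ≤ L := by omega
  have hxz : lay i j x ≠ lay i j z := by rw [hx, hz]; exact cast_c_ne_neg_odd hc hL
  have hcv : ∀ a : Fin 4, ∃ q ∈ Q, HasLink q (link (sq k l hkl x) a) := by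
    intro a
    by_contra h
    push Not at h
    exact hT (pairT_eq_zero_of_uncovered_right ρ β hρ hL3 hz₀ hω ⟨a, rfl⟩
      (not_hasLink_sq_of_lay_ne hij hjk hkl hxz a) h)
  have hcu : ∀ a : Fin 4, ∃ q ∈ Q, HasLink q (link (sq k l hkl z) a) := by
    intro a
    by_contra h
    push Not at h
    exact hT (pairT_eq_zero_of_uncovered_left ρ β hρ hL3 hz₀ hω ⟨a, rfl⟩
      (not_hasLink_sq_of_lay_ne hij hjk hkl (Ne.symm hxz) a) h)
  choose qv hqvQ hqvL using hcv
  have hvt : ∀ a, qv a = ring (hij.trans hjk) (hij.trans (hjk.trans hkl)) x a ∨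
      qv a = ring hjk (hjk.trans hkl) (dn x j) a :=
    fun a => cover_low_odd hij hjk hkl hc hL hx (hQ (hqvQ a)) (hqvL a)
  have hinj : Function.Injective qv := fun a b h =>
    eq_of_hasLink_vface hij hjk hkl hL3 (hvt a) (by rw [h]; exact hqvL b)
  have himg : univ.image qv = Q := by
    apply eq_of_subset_of_card_le
    · intro q hq
      obtain ⟨a, _, rfl⟩ := mem_image.1 hq
      exact hqvQ a
    · rw [card_image_of_injective _ hinj]; simpa using hcard
  refine ⟨qv, fun a => ⟨hqvQ a, hqvL a, hvt a⟩, fun q hq => ?_, fun b => ?_⟩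
  · rw [← himg] at hq
    obtain ⟨a, _, rfl⟩ := mem_image.1 hq
    exact ⟨a, rfl⟩
  · obtain ⟨q, hq, hqb⟩ := hcu b
    rw [← himg] at hq
    obtain ⟨a, _, rfl⟩ := mem_image.1 hq
    exact ⟨a, hqb⟩

section WithCover

variable {Q : Finset (Plaquette d L)} {qv : Fin 4 → Plaquette d L}
  (hv : ∀ a, qv a ∈ Q ∧ HasLink (qv a) (link (sq k l hkl x) a) ∧
    (qv a = ring (hij.trans hjk) (hij.trans (hjk.trans hkl)) x a ∨
      qv a = ring hjk (hjk.trans hkl) (dn x j) a))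
  (hex : ∀ q ∈ Q, ∃ a, q = qv a)

include hv hex

/-- **A lonely link in a covering face kills the term** (odd torus). -/
theorem pairT_eq_zero_of_lonely_odd (a : Fin 4) {ℓ : Edge d L} (h1 : HasLink (qv a) ℓ)
    (h2 : ¬ HasLink (sq k l hkl x) ℓ) (h3 : ¬ HasLink (sq k l hkl z) ℓ)
    (h4 : ∀ b, b ≠ a → ¬ HasLink (qv b) ℓ) :
    pairT ρ β Q (sq k l hkl z) (sq k l hkl x) = 0 := by
  have hL3 : 3 ≤ L := by omega
  have hxz : lay i j x ≠ lay i j z := by rw [hx, hz]; exact cast_c_ne_neg_odd hc hL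
  have hlone : ∀ q' ∈ Q, q' ≠ qv a → ¬ HasLink q' ℓ := by
    intro q' hq' hne
    obtain ⟨b, rfl⟩ := hex q' hq'
    exact h4 b fun hb => hne (by rw [hb])
  obtain ⟨κ, hκ⟩ := pairT_eq_mul_pairT_erase ρ β hρ hL3 (hv a).1 h1 hlone h3 h2
  rw [hκ]
  suffices h0 : pairT ρ β (Q.erase (qv a)) (sq k l hkl z) (sq k l hkl x) = 0 by rw [h0, mul_zero]
  refine pairT_eq_zero_of_uncovered_right ρ β hρ hL3 hz₀ hω ⟨a, rfl⟩
    (not_hasLink_sq_of_lay_ne hij hjk hkl hxz a) fun q' hq' => ?_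
  obtain ⟨hne, hq'Q⟩ := mem_erase.1 hq'
  obtain ⟨b, rfl⟩ := hex q' hq'Q
  exact fun h => hne (by rw [eq_of_hasLink_vface hij hjk hkl hL3 (hv b).2.2 h])

/-- **Mixed corners kill the term** (odd torus): adjacent edges of `v` covered by faces of
different types make the term vanish. -/
theorem pairT_eq_zero_of_mixed_odd (a a' : Fin 4) (hadj : a' = a + 1 ∨ a = a' + 1)
    (ha : qv a = ring (hij.trans hjk) (hij.trans (hjk.trans hkl)) x a)
    (ha' : qv a' = ring hjk (hjk.trans hkl) (dn x j) a') :
    pairT ρ β Q (sq k l hkl z) (sq k l hkl x) = 0 := by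
  have hL3 : 3 ≤ L := by omega
  have hij' : i ≠ j := ne_of_lt hij
  have hik' : i ≠ k := ne_of_lt (hij.trans hjk)
  have hil' : i ≠ l := ne_of_lt (hij.trans (hjk.trans hkl))
  obtain ⟨w, hwa, hwa', hother⟩ : ∃ w : Site d L, (w = eStart k l x a ∨ w = eEnd k l x a) ∧
      (w = eStart k l x a' ∨ w = eEnd k l x a') ∧
      ∀ b : Fin 4, b ≠ a → b ≠ a' → w ≠ eStart k l x b ∧ w ≠ eEnd k l x b := by
    rcases hadj with rfl | rfl
    · exact corner_adj hkl hL3 x a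
    · obtain ⟨w, h1, h2, h3⟩ := corner_adj hkl hL3 x a'
      exact ⟨w, h2, h1, fun b hb hb' => h3 b hb' hb⟩
  refine pairT_eq_zero_of_lonely_odd hij hjk hkl hc hL hρ hz₀ hω hx hz hv hex a
    (ℓ := (w, i)) ?_ ?_ ?_ ?_
  · rw [ha]
    rcases hwa with rfl | rfl
    · exact hasLink_ring_start _ _ hkl x a
    · exact hasLink_ring_end _ _ hkl x a
  · intro h; rcases dir_of_hasLink_sq hkl h with h | h <;> [exact hik' h; exact hil' h]
  · intro h; rcases dir_of_hasLink_sq hkl h with h | h <;> [exact hik' h; exact hil' h]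
  · intro b hb h
    rcases (hv b).2.2 with hb' | hb'
    · rw [hb'] at h
      by_cases hba' : b = a'
      · rw [hba', ha'] at hb'
        exact hij' (congrArg (fun q : Plaquette d L => q.2.1.1) hb'.symm)
      · obtain ⟨hs, he⟩ := hother b hb hba'
        rcases hasLink_ring_longitudinal _ _ hkl h with h' | h'
        · exact hs h'
        · exact he h'
    · rw [hb'] at h
      exact not_hasLink_ring_of_dir _ _ hkl hij' hik' hil' h

/-- **Uniform types** (odd torus): all four covering faces are `-e_j` faces, or all are `+e_i`
faces. -/
theorem types_uniform_odd (hT : pairT ρ β Q (sq k l hkl z) (sq k l hkl x) ≠ 0) :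
    (∀ a, qv a = ring hjk (hjk.trans hkl) (dn x j) a) ∨
      (∀ a, qv a = ring (hij.trans hjk) (hij.trans (hjk.trans hkl)) x a) := by
  have M : ∀ a a' : Fin 4, (a' = a + 1 ∨ a = a' + 1) →
      qv a = ring (hij.trans hjk) (hij.trans (hjk.trans hkl)) x a →
      qv a' = ring hjk (hjk.trans hkl) (dn x j) a' → False := fun a a' hadj ha ha' =>
    hT (pairT_eq_zero_of_mixed_odd hij hjk hkl hc hL hρ hz₀ hω hx hz hv hex a a' hadj ha ha')
  have step : ∀ a : Fin 4, (qv a = ring (hij.trans hjk) (hij.trans (hjk.trans hkl)) x a ↔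
      qv (a + 1) = ring (hij.trans hjk) (hij.trans (hjk.trans hkl)) x (a + 1)) := by
    intro a
    constructor
    · intro ha
      rcases (hv (a + 1)).2.2 with h | h
      · exact h
      · exact (M a (a + 1) (Or.inl rfl) ha h).elim
    · intro ha
      rcases (hv a).2.2 with h | h
      · exact h
      · exact (M (a + 1) a (Or.inr rfl) ha h).elim
  rcases (hv 0).2.2 with h0 | h0
  · right
    have h1 := (step 0).1 h0
    have h2 := (step 1).1 h1
    have h3 := (step 2).1 h2
    intro a; fin_cases a <;> assumption
  · left
    have hne : ∀ a, qv a ≠ ring (hij.trans hjk) (hij.trans (hjk.trans hkl)) x a →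
        qv a = ring hjk (hjk.trans hkl) (dn x j) a := fun a hna => (hv a).2.2.resolve_left hna
    have hij' : i ≠ j := ne_of_lt hij
    have hnot : ∀ a, qv a = ring hjk (hjk.trans hkl) (dn x j) a →
        qv a ≠ ring (hij.trans hjk) (hij.trans (hjk.trans hkl)) x a := fun a ha h =>
      hij' (congrArg (fun q : Plaquette d L => q.2.1.1) (h.symm.trans ha))
    have h3 : qv 3 = _ := hne 3 fun h => hnot 0 h0 ((step 3).1 h)
    have h2 : qv 2 = _ := hne 2 fun h => hnot 3 h3 ((step 2).1 h)
    have h1 : qv 1 = _ := hne 1 fun h => hnot 2 h2 ((step 1).1 h)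
    intro a; fin_cases a <;> assumption

end WithCover

/-- ★ **THE SHAPE OF A NON-ZERO SMALL TERM (odd torus)**: a ring of four faces, `z = x + e_i`
(the `+e_i` faces over `v`) or `z = x - e_j` (the `-e_j` faces). -/
theorem tube_shape_odd {Q : Finset (Plaquette d L)} (hQ : Q ⊆ restPlaqs i j (c + 1))
    (hcard : Q.card ≤ 4) (hT : pairT ρ β Q (sq k l hkl z) (sq k l hkl x) ≠ 0) :
    (z = x.shift i ∧ Q = univ.image (ring (hij.trans hjk) (hij.trans (hjk.trans hkl)) x)) ∨
      (z = dn x j ∧ Q = univ.image (ring hjk (hjk.trans hkl) (dn x j))) := by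
  have hL3 : 3 ≤ L := by omega
  have hik : i < k := hij.trans hjk
  have hil : i < l := hij.trans (hjk.trans hkl)
  have hjl : j < l := hjk.trans hkl
  have hxz : lay i j x ≠ lay i j z := by rw [hx, hz]; exact cast_c_ne_neg_odd hc hL
  obtain ⟨qv, hv, hex, hu⟩ := cover_structure_odd hij hjk hkl hc hL hρ hz₀ hω hx hz hQ hcard hT
  have hQeq : Q = univ.image qv := by
    ext q
    simp only [mem_image, mem_univ, true_and]
    exact ⟨fun hq => by obtain ⟨a, rfl⟩ := hex q hq; exact ⟨a, rfl⟩,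
      fun ⟨a, ha⟩ => ha ▸ (hv a).1⟩
  rcases types_uniform_odd hij hjk hkl hc hL hρ hz₀ hω hx hz hv hex hT with hJ | hI
  swap
  · left
    -- every edge of `u` is an edge of `sq (x + e_i)`
    have hlinks : ∀ b : Fin 4, ∃ a : Fin 4, link (sq k l hkl (x.shift i)) a = link (sq k l hkl z) b := by
      intro b
      obtain ⟨a, ha⟩ := hu b
      rw [hI a, link_sq] at ha
      rcases hasLink_ring_transverse hik hil hkl (eDir_eq_or b) ha with h' | h'
      · exact ⟨a, h'.symm.trans (link_sq hkl z b).symm⟩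
      · exfalso
        exact not_hasLink_sq_of_lay_ne hij hjk hkl (Ne.symm hxz) b ⟨a, h'.symm.trans (link_sq hkl z b).symm⟩
    have hzx : z = x.shift i := sq_eq_of_links hkl hL3 hlinks
    exact ⟨hzx, by rw [hQeq, show qv = _ from funext hI]⟩
  · right
    have hlinks : ∀ b : Fin 4, ∃ a : Fin 4, link (sq k l hkl (dn x j)) a = link (sq k l hkl z) b := by
      intro b
      obtain ⟨a, ha⟩ := hu b
      rw [hJ a, link_sq] at ha
      rcases hasLink_ring_transverse hjk hjl hkl (eDir_eq_or b) ha with h' | h'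
      · exfalso
        rw [dn_shift] at h'
        exact not_hasLink_sq_of_lay_ne hij hjk hkl (Ne.symm hxz) b ⟨a, h'.symm.trans (link_sq hkl z b).symm⟩
      · exact ⟨a, h'.symm.trans (link_sq hkl z b).symm⟩
    have hzx : z = dn x j := sq_eq_of_links hkl hL3 hlinks
    exact ⟨hzx, by rw [hQeq, show qv = _ from funext hJ]⟩

/-- **No short-tube offset, no small term** (odd torus). -/
theorem pairT_eq_zero_of_ne_offsets_odd (h1 : z ≠ x.shift i) (h2 : z ≠ dn x j)
    {Q : Finset (Plaquette d L)} (hQ : Q ⊆ restPlaqs i j (c + 1)) (hcard : Q.card ≤ 4) :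
    pairT ρ β Q (sq k l hkl z) (sq k l hkl x) = 0 := by
  by_contra hT
  rcases tube_shape_odd hij hjk hkl hc hL hρ hz₀ hω hx hz hQ hcard hT with ⟨h, -⟩ | ⟨h, -⟩
  · exact h1 h
  · exact h2 h

/-- ★ **The short `i`-tube** (`z = x + e_i`): the only surviving `Q` is the set of the four
`+e_i` faces. -/
theorem eq_ringI_of_pairT_ne_zero (hzx : z = x.shift i) {Q : Finset (Plaquette d L)}
    (hQ : Q ⊆ restPlaqs i j (c + 1)) (hcard : Q.card ≤ 4)
    (hT : pairT ρ β Q (sq k l hkl z) (sq k l hkl x) ≠ 0) :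
    Q = univ.image (ring (hij.trans hjk) (hij.trans (hjk.trans hkl)) x) := by
  have hij' : i ≠ j := ne_of_lt hij
  rcases tube_shape_odd hij hjk hkl hc hL hρ hz₀ hω hx hz hQ hcard hT with ⟨-, h⟩ | ⟨h, -⟩
  · exact h
  · exfalso
    have e := congrFun (hzx.symm.trans h) i
    simp only [Site.shift, dn, Pi.add_apply, Pi.sub_apply, Pi.single_eq_same,
      Pi.single_eq_of_ne hij'] at e
    exact one_ne_zero_of_three_le (by omega : 3 ≤ L) (by linear_combination e)

/-- ★ **The short `j`-tube** (`z = x - e_j`): the only surviving `Q` is the set of the four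
`-e_j` faces. -/
theorem eq_ringJ_of_pairT_ne_zero (hzx : z = dn x j) {Q : Finset (Plaquette d L)}
    (hQ : Q ⊆ restPlaqs i j (c + 1)) (hcard : Q.card ≤ 4)
    (hT : pairT ρ β Q (sq k l hkl z) (sq k l hkl x) ≠ 0) :
    Q = univ.image (ring hjk (hjk.trans hkl) (dn x j)) := by
  have hij' : i ≠ j := ne_of_lt hij
  rcases tube_shape_odd hij hjk hkl hc hL hρ hz₀ hω hx hz hQ hcard hT with ⟨h, -⟩ | ⟨-, h⟩
  · exfalso
    have e := congrFun (hzx.symm.trans h) i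
    simp only [Site.shift, dn, Pi.add_apply, Pi.sub_apply, Pi.single_eq_same,
      Pi.single_eq_of_ne hij'] at e
    exact one_ne_zero_of_three_le (by omega : 3 ≤ L) (by linear_combination -e)
  · exact h

end DiagRPTube

end

end Summit.QuantumFields.GaugeBoot
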